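import Mathlib
import Summits.ValiantsHypothesis.ValiantsHypothesis.Theorems.BarrierLeverPartitionMinorsHitByVPHiddenStatesSymbolic

/-!
# Route BarrierLever — item `PartitionMinorsHitByVP` (stmt-ValiantsHypothesis-19717), line `hidden-states`:
# THE SYMBOLIC SPLIT STEP WITH EXPLICIT ENUMERATIONS — the certificate-checkable form of `SymbJoin.symGood_of_split`

Helper file (`--supports stmt-ValiantsHypothesis-19717`; cell valiant-natproofs, rung V4, 𝒟-side door (c), registered line
`Cruxes/PartitionMinorsHitByVP/Lines/hidden_states.lean` v2, lane `stub_universalJoinWide`; prover seat val-np-p3 gen 10).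
Definition-free (imports `…HiddenStatesSymbolic`). Closes NO item.

THE POINT. `SymbJoin.symGood_of_split` takes the row/column sortings as equivalences `Fin r₀ ⊕ Fin r₁ ≃ Fin r`, awkward to write down for a
concrete certificate. `symGood_of_split_enum` takes instead four explicit ENUMERATIONS — deletion rows `f₀`, link rows `f₁`, unscaled
columns `g₀`, scaled columns `g₁` — with `r₀ + r₁ = r` and injectivity of the combined maps (all `decide`-able for concrete data), builds the
equivalences by counting (`Fintype.bijective_iff_injective_and_card`), and concludes generic goodness of `(u, e)` from generic goodness of
`(u ∘ f₀, e ∘ g₀)` and `((u ∘ f₁).erase x, e ∘ g₁)`. This is the step a certificate compiler emits once per node of an F⁺ tree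
(memo val-np-p3 g10 §10–§11); leaves are `SymbJoin.symGood_of_lonely`, the root `SymbJoin.exists_table_of_symGood`.

WHAT THIS IS NOT: no family is certified here; item 19717 OPEN; nothing on crux 14610 or VP ≠ VNP.
-/

set_option linter.dupNamespace false

namespace Summit.ValiantsHypothesis.ValiantsHypothesis.Theorems.BarrierLever.HiddenStates

open Finset Matrix MvPolynomial

noncomputable section

namespace SymbJoin

variable {h m K r r₀ r₁ : ℕ}

/-- An injective map `Fin r₀ ⊕ Fin r₁ → Fin r` with `r₀ + r₁ = r` is a bijection. -/
theorem bijective_sumElim (f₀ : Fin r₀ → Fin r) (f₁ : Fin r₁ → Fin r) (hr : r₀ + r₁ = r)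
    (hinj : Function.Injective (Sum.elim f₀ f₁)) : Function.Bijective (Sum.elim f₀ f₁) := by
  rw [Fintype.bijective_iff_injective_and_card]
  exact ⟨hinj, by simp [Fintype.card_sum, hr]⟩

/-- **Split step with explicit enumerations.** Rows `f₀ j` avoid `x`, rows `f₁ j` contain `x`; columns `g₀ j` have cut value `ξ = 0`,
columns `g₁ j` have `ξ ≠ 0`; the combined enumerations are injective and exhaust `Fin r` (`r₀ + r₁ = r`). Then generic goodness of the
deletion configuration `(u ∘ f₀, e ∘ g₀)` and of the link configuration `(x erased from u ∘ f₁, e ∘ g₁)` give generic goodness of `(u, e)`. -/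
theorem symGood_of_split_enum (u : Fin r → Finset (Fin h)) (e : Fin r → Fin m × Finset (Fin K)) (x : Fin h)
    (β : Fin m → ℂ) (γ : Fin m → Fin K → ℂ) (hr : r₀ + r₁ = r)
    (f₀ : Fin r₀ → Fin r) (f₁ : Fin r₁ → Fin r) (g₀ : Fin r₀ → Fin r) (g₁ : Fin r₁ → Fin r)
    (hf : Function.Injective (Sum.elim f₀ f₁)) (hg : Function.Injective (Sum.elim g₀ g₁))
    (hrow0 : ∀ j, x ∉ u (f₀ j)) (hrow1 : ∀ j, x ∈ u (f₁ j))
    (hcol0 : ∀ j, xi e β γ (g₀ j) = 0) (hcol1 : ∀ j, xi e β γ (g₁ j) ≠ 0)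
    (h0 : symDet (fun j : Fin r₀ => u (f₀ j)) (fun j => e (g₀ j)) ≠ 0)
    (h1 : symDet (fun j : Fin r₁ => (u (f₁ j)).erase x) (fun j => e (g₁ j)) ≠ 0) :
    symDet u e ≠ 0 := by
  let er : Fin r₀ ⊕ Fin r₁ ≃ Fin r := Equiv.ofBijective _ (bijective_sumElim f₀ f₁ hr hf)
  let ec : Fin r₀ ⊕ Fin r₁ ≃ Fin r := Equiv.ofBijective _ (bijective_sumElim g₀ g₁ hr hg)
  exact symGood_of_split u e x β γ er ec hrow0 hrow1 hcol0 hcol1 h0 h1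

/-- **The whole pipeline in one statement**: a generically good configuration yields the `∃ tx` conclusion of the line's stubs for that
`(u, e)` (restated from `…HiddenStatesSymbolic` for certificate roots). -/
theorem exists_table_of_symDet_ne_zero (u : Fin r → Finset (Fin h)) (e : Fin r → Fin m × Finset (Fin K)) (hG : symDet u e ≠ 0) :
    ∃ tx : Fin m → Option (Fin K) → Fin h → ℂ,
      (Matrix.of fun i k : Fin r =>
        ∏ a ∈ u i, (tx (e k).1 none a + ∑ q ∈ (e k).2, tx (e k).1 (some q) a)).det ≠ 0 :=
  exists_table_of_symGood u e hG

end SymbJoin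

end

end Summit.ValiantsHypothesis.ValiantsHypothesis.Theorems.BarrierLever.HiddenStates
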